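import Mathlib.Algebra.Polynomial.Div
import Mathlib.Tactic.FieldSimp
import Mathlib.Tactic.Ring
import Mathlib.Tactic.IntervalCases
import HarnessLib

/-!
# BirchSwinnertonDyer — rank-2 `Ш[p^∞]` cell, STRUCTURE track: Lagrange inversion to order 4 — the coefficient `P₄` (T23, part 1)

HONEST FRAMING (cell `b2b-bsdr2sha`, run/shared/lean/b2b/bsd-rank2-sha/; STRUCTURE.md v6.49 P-032 candidate (xxxii‴) «T23 = P₄ by
series reversion + 12⁴θ⁴F as the one-screen extension of T22 (P2 desk)»; THEORY-NOTE-C5 §24.1/§24.6(a), §25 «ALL ORDERS» / «EXACT JET»):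
ELEMENTARY COMMUTATIVE ALGEBRA ONLY — the order-4 step of the expansion «Taylor in `δ` ∘ compositional inverse of `d(δ)`» used by
P-030/P-031, with the fourth coefficient in CLOSED FORM. This part is Mathlib-only (no project import), so it does not wait for
any hub olean; the companion `12⁴θ⁴F` closed forms in T21's ring `ℤ[P,Q,R,S]` follow separately (they import T21).

* In `K[X]` over any commutative ring, for `δ = a₁X + a₂X² + a₃X³ + a₄X⁴` (powers collected: `quartic_sq`, `quartic_cube`,
  `quartic_pow_four`): `b₁δ + b₂δ² + b₃δ³ + b₄δ⁴ ≡ c₁X + c₂X² + c₃X³ + c₄X⁴ (mod X⁵)` whenever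
  `c₁ = b₁a₁`, `c₂ = b₁a₂ + b₂a₁²`, `c₃ = b₁a₃ + 2b₂a₁a₂ + b₃a₁³`, `c₄ = b₁a₄ + b₂(2a₁a₃ + a₂²) + 3b₃a₁²a₂ + b₄a₁⁴`
  (the four low coefficients, via `Polynomial.X_pow_dvd_iff`) [`X_pow_five_dvd_comp_quartic_sub`].
* `lagrange_inversion_order4`: over a field of characteristic `0`, `J₁ ≠ 0`, with the INVERSE JET
  `a₁ = 1/J₁`, `a₂ = −J₂/(2J₁³)`, `a₃ = (3J₂² − J₁J₃)/(6J₁⁵)`, `a₄ = (−15J₂³ + 10J₁J₂J₃ − J₁²J₄)/(24J₁⁷)`: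
  `(bₙ) = (J₁, J₂/2, J₃/6, J₄/24)` yields `(c₁,c₂,c₃,c₄) = (1,0,0,0)` — `δ` inverts `d = Σₙ≤4 Jₙδⁿ/n!` to order 4 — and
  `(bₙ) = (F₁, F₂/2, F₃/6, F₄/24)` yields `P₁ = F₁/J₁`, `P₂ = (F₂J₁ − F₁J₂)/(2J₁³)`, `P₃ = (F₁(3J₂² − J₁J₃) − 3F₂J₂J₁ + F₃J₁²)/(6J₁⁵)`
  (as in T22 / THEORY-NOTE 24.1) and the NEW closed form
  **`P₄ = (F₁(−15J₂³ + 10J₁J₂J₃ − J₁²J₄) + F₂J₁(15J₂² − 4J₁J₃) − 6F₃J₁²J₂ + F₄J₁³)/(24J₁⁷)`**;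
  combined [`taylor_comp_inverse_jet4`]: `X⁵ ∣ Σₙ≤4 (Jₙ/n!)δⁿ − X` and `X⁵ ∣ Σₙ≤4 (Fₙ/n!)δⁿ − (P₁X + P₂X² + P₃X³ + P₄X⁴)` in `K[X]`.
  Read with `Fₙ = θⁿF`, `Jₙ = θⁿj` at the current level (THEORY-NOTE 24.1): `u^{k′}F′ − F = P₁d + P₂d² + P₃d³ + P₄d⁴ + O(d⁵)`.

NOT TYPED: anything `p`-adic or modular (which `F`, the U/V-tower identification, the error budget 24.2); nothing on BSD, `Ш`, heights.
No definition, no named fact, no axiom, no `sorry`. References: THEORY-NOTE-C5.md §24–25 (LEAD g12, 2026-08-24); classical series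
reversion (Lagrange 1770; e.g. the `y⁴` coefficient `−5b₂³ + 5b₂b₃ − b₄` of the inverse of `y = x + b₂x² + b₃x³ + b₄x⁴`).
-/

set_option autoImplicit false

-- single-conjunct summit: `Summit.BirchSwinnertonDyer.BirchSwinnertonDyer.…` repeats the name by design
set_option linter.dupNamespace false

namespace Summit.BirchSwinnertonDyer.BirchSwinnertonDyer.Rank2Sha.Structure.ThetaJet

open Polynomial

section AnyRing

variable {L : Type*} [CommRing L]

/-- `δ²` for the quartic `δ = a₁X + a₂X² + a₃X³ + a₄X⁴`, collected by powers of `X` -/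
theorem quartic_sq (a₁ a₂ a₃ a₄ : L) :
    (C a₁ * X + C a₂ * X ^ 2 + C a₃ * X ^ 3 + C a₄ * X ^ 4) ^ 2 =
      C (a₁ ^ 2) * X ^ 2 + C (2 * a₁ * a₂) * X ^ 3 + C (2 * a₁ * a₃ + a₂ ^ 2) * X ^ 4 + C (2 * a₁ * a₄ + 2 * a₂ * a₃) * X ^ 5 +
      C (2 * a₂ * a₄ + a₃ ^ 2) * X ^ 6 + C (2 * a₃ * a₄) * X ^ 7 + C (a₄ ^ 2) * X ^ 8 := by
  simp only [map_add, map_mul, map_pow, map_ofNat]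
  ring

/-- `δ³`, collected by powers of `X` -/
theorem quartic_cube (a₁ a₂ a₃ a₄ : L) :
    (C a₁ * X + C a₂ * X ^ 2 + C a₃ * X ^ 3 + C a₄ * X ^ 4) ^ 3 =
      C (a₁ ^ 3) * X ^ 3 + C (3 * a₁ ^ 2 * a₂) * X ^ 4 + C (3 * a₁ ^ 2 * a₃ + 3 * a₁ * a₂ ^ 2) * X ^ 5 +
      C (3 * a₁ ^ 2 * a₄ + 6 * a₁ * a₂ * a₃ + a₂ ^ 3) * X ^ 6 + C (6 * a₁ * a₂ * a₄ + 3 * a₁ * a₃ ^ 2 + 3 * a₂ ^ 2 * a₃) * X ^ 7 +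
      C (6 * a₁ * a₃ * a₄ + 3 * a₂ ^ 2 * a₄ + 3 * a₂ * a₃ ^ 2) * X ^ 8 + C (3 * a₁ * a₄ ^ 2 + 6 * a₂ * a₃ * a₄ + a₃ ^ 3) * X ^ 9 +
      C (3 * a₂ * a₄ ^ 2 + 3 * a₃ ^ 2 * a₄) * X ^ 10 + C (3 * a₃ * a₄ ^ 2) * X ^ 11 + C (a₄ ^ 3) * X ^ 12 := by
  have h2 := quartic_sq a₁ a₂ a₃ a₄
  calc (C a₁ * X + C a₂ * X ^ 2 + C a₃ * X ^ 3 + C a₄ * X ^ 4) ^ 3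
        = (C a₁ * X + C a₂ * X ^ 2 + C a₃ * X ^ 3 + C a₄ * X ^ 4) ^ 2 * (C a₁ * X + C a₂ * X ^ 2 + C a₃ * X ^ 3 + C a₄ * X ^ 4) := by
          ring
    _ = _ := by
          rw [h2]
          simp only [map_add, map_mul, map_pow, map_ofNat]
          ring

/-- `δ⁴`, collected by powers of `X` -/
theorem quartic_pow_four (a₁ a₂ a₃ a₄ : L) :
    (C a₁ * X + C a₂ * X ^ 2 + C a₃ * X ^ 3 + C a₄ * X ^ 4) ^ 4 =
      C (a₁ ^ 4) * X ^ 4 + C (4 * a₁ ^ 3 * a₂) * X ^ 5 + C (4 * a₁ ^ 3 * a₃ + 6 * a₁ ^ 2 * a₂ ^ 2) * X ^ 6 +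
      C (4 * a₁ ^ 3 * a₄ + 12 * a₁ ^ 2 * a₂ * a₃ + 4 * a₁ * a₂ ^ 3) * X ^ 7 +
      C (12 * a₁ ^ 2 * a₂ * a₄ + 6 * a₁ ^ 2 * a₃ ^ 2 + 12 * a₁ * a₂ ^ 2 * a₃ + a₂ ^ 4) * X ^ 8 +
      C (12 * a₁ ^ 2 * a₃ * a₄ + 12 * a₁ * a₂ ^ 2 * a₄ + 12 * a₁ * a₂ * a₃ ^ 2 + 4 * a₂ ^ 3 * a₃) * X ^ 9 +
      C (6 * a₁ ^ 2 * a₄ ^ 2 + 24 * a₁ * a₂ * a₃ * a₄ + 4 * a₁ * a₃ ^ 3 + 4 * a₂ ^ 3 * a₄ + 6 * a₂ ^ 2 * a₃ ^ 2) * X ^ 10 +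
      C (12 * a₁ * a₂ * a₄ ^ 2 + 12 * a₁ * a₃ ^ 2 * a₄ + 12 * a₂ ^ 2 * a₃ * a₄ + 4 * a₂ * a₃ ^ 3) * X ^ 11 +
      C (12 * a₁ * a₃ * a₄ ^ 2 + 6 * a₂ ^ 2 * a₄ ^ 2 + 12 * a₂ * a₃ ^ 2 * a₄ + a₃ ^ 4) * X ^ 12 +
      C (4 * a₁ * a₄ ^ 3 + 12 * a₂ * a₃ * a₄ ^ 2 + 4 * a₃ ^ 3 * a₄) * X ^ 13 + C (4 * a₂ * a₄ ^ 3 + 6 * a₃ ^ 2 * a₄ ^ 2) * X ^ 14 +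
      C (4 * a₃ * a₄ ^ 3) * X ^ 15 + C (a₄ ^ 4) * X ^ 16 := by
  have h2 := quartic_sq a₁ a₂ a₃ a₄
  calc (C a₁ * X + C a₂ * X ^ 2 + C a₃ * X ^ 3 + C a₄ * X ^ 4) ^ 4
        = ((C a₁ * X + C a₂ * X ^ 2 + C a₃ * X ^ 3 + C a₄ * X ^ 4) ^ 2) ^ 2 := by ring
    _ = _ := by
          rw [h2]
          simp only [map_add, map_mul, map_pow, map_ofNat]
          ring

/-- **Matching the four low coefficients ⇒ agreement mod `X⁵`**: for `δ = a₁X + a₂X² + a₃X³ + a₄X⁴`,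
`[X¹…X⁴](b₁δ + b₂δ² + b₃δ³ + b₄δ⁴) = (b₁a₁, b₁a₂ + b₂a₁², b₁a₃ + 2b₂a₁a₂ + b₃a₁³, b₁a₄ + b₂(2a₁a₃ + a₂²) + 3b₃a₁²a₂ + b₄a₁⁴)`,
so these four equalities give `X⁵ ∣ b₁δ + b₂δ² + b₃δ³ + b₄δ⁴ − (c₁X + c₂X² + c₃X³ + c₄X⁴)` (any commutative ring). -/
theorem X_pow_five_dvd_comp_quartic_sub (a₁ a₂ a₃ a₄ b₁ b₂ b₃ b₄ c₁ c₂ c₃ c₄ : L) (h₁ : b₁ * a₁ = c₁)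
    (h₂ : b₁ * a₂ + b₂ * a₁ ^ 2 = c₂) (h₃ : b₁ * a₃ + 2 * b₂ * a₁ * a₂ + b₃ * a₁ ^ 3 = c₃)
    (h₄ : b₁ * a₄ + b₂ * (2 * a₁ * a₃ + a₂ ^ 2) + 3 * b₃ * a₁ ^ 2 * a₂ + b₄ * a₁ ^ 4 = c₄) :
    X ^ 5 ∣ C b₁ * (C a₁ * X + C a₂ * X ^ 2 + C a₃ * X ^ 3 + C a₄ * X ^ 4) +
        C b₂ * (C a₁ * X + C a₂ * X ^ 2 + C a₃ * X ^ 3 + C a₄ * X ^ 4) ^ 2 +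
        C b₃ * (C a₁ * X + C a₂ * X ^ 2 + C a₃ * X ^ 3 + C a₄ * X ^ 4) ^ 3 +
        C b₄ * (C a₁ * X + C a₂ * X ^ 2 + C a₃ * X ^ 3 + C a₄ * X ^ 4) ^ 4 -
      (C c₁ * X + C c₂ * X ^ 2 + C c₃ * X ^ 3 + C c₄ * X ^ 4) := by
  subst h₁ h₂ h₃ h₄
  rw [quartic_sq, quartic_cube, quartic_pow_four, Polynomial.X_pow_dvd_iff]
  intro d hd
  interval_cases d <;> simp only [coeff_add, coeff_sub, coeff_C_mul] <;> simp [coeff_X_pow, coeff_X] <;> ring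

end AnyRing

section CharZeroField

variable {K : Type*} [Field K] [CharZero K]

/-- **The inverse jet to order 4 and `P₁ … P₄`.** With `a₁ = 1/J₁`, `a₂ = −J₂/(2J₁³)`, `a₃ = (3J₂² − J₁J₃)/(6J₁⁵)`,
`a₄ = (−15J₂³ + 10J₁J₂J₃ − J₁²J₄)/(24J₁⁷)` (`J₁ ≠ 0`): composing with `(J₁, J₂/2, J₃/6, J₄/24)` gives `(1, 0, 0, 0)`, and composing
with `(F₁, F₂/2, F₃/6, F₄/24)` gives `P₁, P₂, P₃` of THEORY-NOTE 24.1 and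
`P₄ = (F₁(−15J₂³ + 10J₁J₂J₃ − J₁²J₄) + F₂J₁(15J₂² − 4J₁J₃) − 6F₃J₁²J₂ + F₄J₁³)/(24J₁⁷)`. -/
theorem lagrange_inversion_order4 (F₁ F₂ F₃ F₄ J₁ J₂ J₃ J₄ : K) (hJ : J₁ ≠ 0) :
    let a₁ := 1 / J₁
    let a₂ := -J₂ / (2 * J₁ ^ 3)
    let a₃ := (3 * J₂ ^ 2 - J₁ * J₃) / (6 * J₁ ^ 5)
    let a₄ := (-15 * J₂ ^ 3 + 10 * J₁ * J₂ * J₃ - J₁ ^ 2 * J₄) / (24 * J₁ ^ 7)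
    (J₁ * a₁ = 1 ∧ J₁ * a₂ + J₂ / 2 * a₁ ^ 2 = 0 ∧ J₁ * a₃ + 2 * (J₂ / 2) * a₁ * a₂ + J₃ / 6 * a₁ ^ 3 = 0 ∧
      J₁ * a₄ + J₂ / 2 * (2 * a₁ * a₃ + a₂ ^ 2) + 3 * (J₃ / 6) * a₁ ^ 2 * a₂ + J₄ / 24 * a₁ ^ 4 = 0) ∧
    (F₁ * a₁ = F₁ / J₁ ∧ F₁ * a₂ + F₂ / 2 * a₁ ^ 2 = (F₂ * J₁ - F₁ * J₂) / (2 * J₁ ^ 3) ∧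
      F₁ * a₃ + 2 * (F₂ / 2) * a₁ * a₂ + F₃ / 6 * a₁ ^ 3 = (F₁ * (3 * J₂ ^ 2 - J₁ * J₃) - 3 * F₂ * J₂ * J₁ + F₃ * J₁ ^ 2) / (6 * J₁ ^ 5) ∧
      F₁ * a₄ + F₂ / 2 * (2 * a₁ * a₃ + a₂ ^ 2) + 3 * (F₃ / 6) * a₁ ^ 2 * a₂ + F₄ / 24 * a₁ ^ 4 =
        (F₁ * (-15 * J₂ ^ 3 + 10 * J₁ * J₂ * J₃ - J₁ ^ 2 * J₄) + F₂ * J₁ * (15 * J₂ ^ 2 - 4 * J₁ * J₃) - 6 * F₃ * J₁ ^ 2 * J₂ +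
          F₄ * J₁ ^ 3) / (24 * J₁ ^ 7)) := by
  refine ⟨⟨?_, ?_, ?_, ?_⟩, ?_, ?_, ?_, ?_⟩ <;> field_simp <;> ring

/-- **Taylor ∘ inverse jet, mod `d⁵`** (THEORY-NOTE 24.6 (a) / 25, order 4 as one statement): in `K[X]` (`X = d`) with the inverse
jet `δ`, `X⁵ ∣ Σₙ≤4 (Jₙ/n!)δⁿ − X` and `X⁵ ∣ Σₙ≤4 (Fₙ/n!)δⁿ − (P₁X + P₂X² + P₃X³ + P₄X⁴)`. -/
theorem taylor_comp_inverse_jet4 (F₁ F₂ F₃ F₄ J₁ J₂ J₃ J₄ : K) (hJ : J₁ ≠ 0) :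
    let δ : K[X] := C (1 / J₁) * X + C (-J₂ / (2 * J₁ ^ 3)) * X ^ 2 + C ((3 * J₂ ^ 2 - J₁ * J₃) / (6 * J₁ ^ 5)) * X ^ 3 +
      C ((-15 * J₂ ^ 3 + 10 * J₁ * J₂ * J₃ - J₁ ^ 2 * J₄) / (24 * J₁ ^ 7)) * X ^ 4
    (X ^ 5 ∣ C J₁ * δ + C (J₂ / 2) * δ ^ 2 + C (J₃ / 6) * δ ^ 3 + C (J₄ / 24) * δ ^ 4 -
      (C 1 * X + C 0 * X ^ 2 + C 0 * X ^ 3 + C 0 * X ^ 4)) ∧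
    (X ^ 5 ∣ C F₁ * δ + C (F₂ / 2) * δ ^ 2 + C (F₃ / 6) * δ ^ 3 + C (F₄ / 24) * δ ^ 4 -
      (C (F₁ / J₁) * X + C ((F₂ * J₁ - F₁ * J₂) / (2 * J₁ ^ 3)) * X ^ 2 +
        C ((F₁ * (3 * J₂ ^ 2 - J₁ * J₃) - 3 * F₂ * J₂ * J₁ + F₃ * J₁ ^ 2) / (6 * J₁ ^ 5)) * X ^ 3 +
        C ((F₁ * (-15 * J₂ ^ 3 + 10 * J₁ * J₂ * J₃ - J₁ ^ 2 * J₄) + F₂ * J₁ * (15 * J₂ ^ 2 - 4 * J₁ * J₃) - 6 * F₃ * J₁ ^ 2 * J₂ +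
          F₄ * J₁ ^ 3) / (24 * J₁ ^ 7)) * X ^ 4)) := by
  obtain ⟨⟨h1, h2, h3, h4⟩, h5, h6, h7, h8⟩ := lagrange_inversion_order4 F₁ F₂ F₃ F₄ J₁ J₂ J₃ J₄ hJ
  exact ⟨X_pow_five_dvd_comp_quartic_sub _ _ _ _ _ _ _ _ _ _ _ _ h1 h2 h3 h4,
    X_pow_five_dvd_comp_quartic_sub _ _ _ _ _ _ _ _ _ _ _ _ h5 h6 h7 h8⟩

end CharZeroField

end Summit.BirchSwinnertonDyer.BirchSwinnertonDyer.Rank2Sha.Structure.ThetaJet
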